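import Literature.MathematicalPhysics.QuantumFieldTheory.Balaban1983to89.B9Eq310Hermitian

/-!
# `Balaban1983to89.B9Eq369Small` — the LOCAL bound (3.69) of B9, p. 404, for the operator `Δ′` of (3.10):
# `|(Δ′A′)(b)| ≤ O(1)·C·(L^jη)⁻²·max_{b′⊂∂p, p∈st(b)}|A′(b′)|` from `|U(∂p) − 1| ≤ Cξ²` on the plaquettes through `b`,
# with the displayed step `|Re U(∂p) − 1|, |Im U(∂p)| ≤ O(1)·|U(∂p) − 1|`, the locality of `Δ′`, and the positivity of the
# principal part `D*D_U` on the unitary group; kernel-checked; v1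

CITATION HEADER (lean-in-tree rule).  Audit cell `pub-balaban`, surge node-prover lineage pv27 (B9 pp. 390–392, 404), unit
`b2b-balaban-pv27-g17` (journal CLAIM l.54016, node B9-EQ369-SMALL).  Source: T. Bałaban, *Propagators for lattice gauge
theories in a background field*, Commun. Math. Phys. **99** (1985) 389–434 [Balaban1985BackgroundPropagators] (cell paper B9;
journal page = PDF page + 388), p. 404 [PDF 16], p. 396 [PDF 8], p. 397 [PDF 9], p. 392 [PDF 4], quoted from the page renders
`b2b-balaban-ref1/pages/1985-cmp99-background-propagators/…-p016-x2.png`, `…-p008-x2.png`, `…-p009-x2.png`, `…-p004-x2.png` READ AS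
IMAGES by this lineage (2026-08-19); the displays (3.1)–(3.12) are quoted in full in the headers of the lineage leaves `B9Eq39Adjoint`,
`B9Eq310Hermitian` (imported BY NAME, transitively).

HONEST FRAMING (cell charter, verbatim in substance).  The cell audits Bałaban's papers; discharging its end statements would
make Bałaban's ultraviolet stability theorem unconditional inside this package — a constructive-QFT statement; it is NOT the
continuum limit and NOT the Clay problem.  THIS FILE DISCHARGES NOTHING of the series: it is finite non-commutative algebra and
triangle-inequality counting on top of the lineage leaf `B9Eq310Hermitian` (imported BY NAME: the operator `deltaPrimeOp` = `Δ′`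
of (3.10), its weights `zP` = `η⁻²(Re U(∂p) − 1)`, `yP` = `η⁻² Im U(∂p)`, the letter functions `jordanF`, `sgnSumₖ`, `commGₖ`, the
letter divergence `divL`, the bound lemmas `norm_jordan_smul_le`, `norm_comm_smul_le`, `sum_ite_lt_add_sum_ite_gt`, the global bound
`norm_deltaPrimeOp_le`, and the `*`-lemmas `star_curlη`, `hessPair_im`, `deltaPrime_im`; through it `B9Eq39Adjoint`: `R`, `covD`,
`curl`, `plaqU`, `divP`, `curlη`, `divPη`, `bondPair`, `deltaPrime`, `hessPair`, `posPlaq`, `bondPair_divPη_curlη`; and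
`B9Eq37Insertion`: the complexified `reC`, `imC`, `imC_eq`).  That leaf proved the GLOBAL sup-norm bound `‖(Δ′A)(b)‖ ≤ 14(d−1)·a·δ`
with the plaquette smallness `δ` a HYPOTHESIS and stated «NOT PROVED HERE: … that (3.35) p. 396 implies the smallness hypotheses
‖z(p)‖, ‖y(p)‖ ≤ δ with B9's constants».  This file proves the printed LOCAL form (3.69) of that bound together with the displayed
reduction of the smallness of `z(p)`, `y(p)` to the smallness of `U(∂p) − 1`, which is how B9 says the estimates follow.  Value =
kernel certificate of a located printed numbered inequality + typed locality objects consumers can import; NOT summit progress.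

ABSOLUTE RULE.  No internally-minted statement enters as a cited fact.  Every declaration below is PROVED (tags `[folklore]`);
the `[cite: …]` tags document WHICH PRINTED DISPLAY a definition or a proved statement transcribes — the proofs are ours, the
print is not used as a hypothesis anywhere.  The plaquette smallness `‖U(∂p) − 1‖ ≤ ε` (resp. `≤ C·(L^j)⁻²`) of §§3–4 is a
HYPOTHESIS of the bounds: B9 takes it from the regularity conditions (3.35)/(3.37), p. 396 — quoted below as the SOURCE of the
assumption; the step (3.35) ⇒ `‖U(∂p) − 1‖ ≤ 2C(1+C)e^{4C}ξ²` for a configuration `U^u = e^{iηA}` on a cube is the sub-cell b09 leaf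
`B9Eq335Plaquette.b7_52_of_b9_335` (tree, accepted; NOT imported here — different carrier, see RELATED), and is NOT re-derived.

WHAT IS IN PRINT («…» verbatim from the renders).
* p. 404 [PDF 16], lines 5–16: «We will estimate terms involving the field U′. Let us consider at first the operator Δ(U′U). It
  is a sum of two operators, Δ(U′U) = D*_{U′U}D_{U′U} + Δ′(U′U). From the formula (3.10) it follows that Δ′(U′U) is a small
  perturbation itself in the sense that we have the bound |(Δ′(U′U)A′)(b)| ≤ O(1)(Mα₀ + α₁)(L^jη)⁻²|A′|, b ∈ Ω_j (3.69) the
  supremum on the right-hand side is taken over bonds belonging to one of the plaquettes containing the bond b (i.e. we have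
  max_{b′:b′⊂∂p,p∈st(b)}|A′(b′)|, where st(b) = {plaquettes p : b ⊂ ∂p and orientation of ∂p agrees with that of b}). This bound
  follows from the estimates |Re(U′U)(∂p) − 1|, |Im(U′U)(∂p)| ≤ O(1)(Mα₀ + α₁)ξ², ξ = L^{−j}. Let us recall that the operations
  Re and Im in this case were defined after formula (3.7), and the estimates follow directly from the assumptions (3.35), (3.37).
  It is easy to see that for the difference Δ′(U′U) − Δ′(U) we have a bound similar to (3.69), but with additional factor α₁. It
  is not essential in the sequal.»
* p. 392 [PDF 4], after (3.10): «We have written it this way because with our assumptions on the configuration U the operator Δ′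
  will be a bounded, small operator, which will be treated as a small perturbation of D*D.»
* p. 396 [PDF 8], the regularity condition: «for an arbitrary cube □ of the described above class, and for a configuration U there
  exists a gauge transformation u on □ such that U^u = e^{iηA}, and if the index of □ is j, then |A| < O(1)Mα₀(L^jη)⁻¹,
  |∇^ηA| < O(1)Mα₀(L^jη)⁻² on □, where O(1)M is a size of □ in T_{L−j} [sic]; (3.35)» … «The number α₀ characterizes this class of
  configurations. We will need α₀ so small that O(1)Mα₀ is still a sufficiently small number.» … «For the operators introduced
  until now we need only the condition (3.35), but later on we will have to assume (3.36) also.» … «We assume that they have the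
  form U′U, where U has values in G and U′ = e^{iηA′}, A′ ∈ g^c. For a given pair of positive numbers α₀, α₁ we consider the class
  of these configurations satisfying: U satisfies the condition (3.35), and |A′| < α₁(L^jη)⁻¹, |∇^η_U A′| < α₁(L^jη)⁻² on Ω_j,
  j = 0,…,k; (3.37)».
* p. 397 [PDF 9]: «Thus we have the supremum norms |A| = max_μ sup_x |A_μ(x)|, |∇A| = max_{μ,ν} sup_x |(D_μA_ν)(x)|, (3.39)».

WHAT THIS FILE PROVES.  MODEL (as in `B9Eq39Adjoint`/`B9Eq310Hermitian`): `𝔸` a ring (a ℂ-algebra; normed where norms occur;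
with a `StarRing`/`StarModule ℂ` involution in §5), `R W X = W·X·W⁻¹`; sites `S`, directions `ι` (finite, linearly ordered), shifts
`T μ : S ≃ S` (bijections; NO commutation assumed), configuration `U : ι → S → 𝔸ˣ` (bond variables `U μ x = U(x, x+ηe_μ)`), bond
fields `A : ι → S → 𝔸`, the plaquette `p_{κν}(y)`, `κ < ν`, with `U(∂p) = plaqU T U κ ν y` and boundary bonds `(κ,y)`, `(ν,T κ y)`,
`(κ,T ν y)`, `(ν,y)`; all norms are those of the `NormedRing` instance (sup norm over bonds = a hypothesis `‖A(b′)‖ ≤ a` per bond,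
the `|·|` of (3.39)).
* §1 (any ℂ-algebra, then normed) THE DISPLAY BELOW (3.69), i.e. `|Re W − 1|, |Im W| = O(|W − 1|)` for a unit `W` (= `U(∂p)` or
  `(U′U)(∂p)`), with the complexified `Re W = ½(W + W⁻¹)`, `Im W = (2i)⁻¹(W − W⁻¹)` of p. 391 (`reC`, `imC`): the identities
  `W⁻¹ − 1 = W⁻¹(1 − W)` (`inv_sub_one_eq`), `Re W − 1 = ½((W − 1) + (W⁻¹ − 1)) = −½(W − 1)(W⁻¹ − 1)` (`reC_sub_one_eq`,
  `reC_sub_one_eq_mul`), `Im W = −(i/2)((W − 1) − (W⁻¹ − 1))` (`imC_eq_sub`); hence for `‖W⁻¹‖ ≤ r`: `‖W⁻¹ − 1‖ ≤ r‖W − 1‖`,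
  **`norm_reC_sub_one_le`** `‖Re W − 1‖ ≤ ½(1 + r)‖W − 1‖`, **`norm_imC_le`** `‖Im W‖ ≤ ½(1 + r)‖W − 1‖`, and the second-order
  `norm_reC_sub_one_le_sq` `‖Re W − 1‖ ≤ (r/2)‖W − 1‖²` (sharper than (3.69) uses; recorded, not needed); on the group (`r = 1`,
  unitaries in the operator norm): `‖Re W − 1‖, ‖Im W‖ ≤ ‖W − 1‖` (`norm_reC_sub_one_le_one`, `norm_imC_le_one`).
* §2 (normed) PLAQUETTE WEIGHTS: `plaqU_inv_val` (`U(∂p)⁻¹ = U_ν(y)U_κ(y+e_ν)U_ν(y+e_κ)⁻¹U_κ(y)⁻¹`, the reversed contour); for bond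
  variables with `‖U(b)‖, ‖U(b)⁻¹‖ ≤ ρ` (`hUρ`): `‖U(∂p)‖, ‖U(∂p)⁻¹‖ ≤ ρ⁴`; `‖(η⁻¹)²‖ = (η²)⁻¹`; **`norm_zP_le_of_plaq`**,
  **`norm_yP_le_of_plaq`**: `‖U(∂p) − 1‖ ≤ ε`, `‖U(∂p)⁻¹‖ ≤ r` ⟹ `‖z(p)‖, ‖y(p)‖ ≤ (η²)⁻¹·½(1 + r)·ε` (`r = 1`: `≤ (η²)⁻¹ε`).
* §3 (normed; `d = |ι|`) **(3.69) AS THE LOCAL BOUND.**  `Through T μ x κ ν y` := `κ < ν ∧ ((ν = μ ∧ (y = x ∨ y = x − e_κ)) ∨ (κ = μ ∧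
  (y = x ∨ y = x − e_ν)))` — the positively oriented plaquettes `p_{κν}(y)` whose boundary contains the bond `b = ⟨x, x+e_μ⟩` (the
  print's `st(b)` up to the orientation convention: these are EXACTLY the `2(d − 1)` plaquettes the sums (3.9)/`divP`/`divL` at `b`
  run over — certified by the LOCALITY theorem **`deltaPrimeOp_congr_local`**: `(Δ′A)(b)` depends on `A` only through its values on
  the boundary bonds of the plaquettes through `b`).  Transport bounds with `‖U(b)^{±1}‖ ≤ ρ`, `1 ≤ ρ` (`ρ = 1` on `U(N)` in the
  operator norm; `ρ > 1` accommodates the non-unitary `U′U` of (3.37)): `norm_R_le_rho` (`ρ²`), `norm_curl_le_loc` (`4ρ²a`),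
  `norm_sgnSum_le_loc` (`3ρ²a`), `norm_jordanF_le_loc` (`4ρ²aδ`), `norm_commG_le_loc` (`3ρ²aδ`), `norm_divL_le_loc` (`2ρ²g(d−1)`),
  all with hypotheses ONLY on the plaquettes through `b` and their boundary bonds; **`norm_deltaPrimeOp_le_local`**:
  `‖(Δ′A)(b)‖ ≤ 14ρ⁴(d − 1)·a·δ` where `a` bounds `‖A(b′)‖` for `b′ ⊂ ∂p`, `p ∈ st(b)` and `δ` bounds `‖z(p)‖, ‖y(p)‖`, `p ∈ st(b)`;
  the group case `norm_deltaPrimeOp_le_local_one` (`14(d−1)·a·δ`); the lineage leaf's GLOBAL bound re-derived from the local one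
  (an `example` — consistency; as a theorem it would restate the landed `norm_deltaPrimeOp_le`); and the PRINTED SHAPE: **`eq369_local`** `‖U(∂p) − 1‖ ≤ ε` on `st(b)` ⟹
  `‖(Δ′A)(b)‖ ≤ 14(d−1)·(η²)⁻¹ε·a`, **`eq369`** `‖U(∂p) − 1‖ ≤ C·(L^j)⁻²` (`= Cξ²`, `ξ = L^{−j}`) on `st(b)` ⟹
  `‖(Δ′A)(b)‖ ≤ (14(d−1))·C·(L^jη)⁻²·a` — (3.69) with `O(1) = 14(d − 1)` and `(Mα₀ + α₁)` entering only through the hypothesis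
  constant `C` (`xi_sq_div_eta_sq`: `(L^{−j})²/η² = (L^jη)⁻²`); the `ρ`-version `eq369_local_rho` (`14ρ⁴(d−1)·(η²)⁻¹·½(1+ρ⁴)ε·a`).
  The output inequality has the input shape `x ≤ c·M·α₀·((L^jη)²)⁻¹·a` of the (3.69)-consumer `B8FromB9.weighted_369_pointwise`
  (reader group r1; not imported).
* §4 (ℂ-algebra with involution; normed where `hessPair` lives) POSITIVITY OF THE PRINCIPAL PART on the unitary group
  (`(U μ x)⁻¹ = (U μ x)*`), for hermitian `A` (`A(b)* = A(b)`), a tracial `τ` with `Re τ(a*a) ≥ 0` and `η ≥ 0`: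
  **`bondPair_DstarD_re_nonneg`** `0 ≤ Re ⟨A, D*D_U A⟩` (`= η^d Σ_p Re τ((D_U A)(p)*(D_U A)(p))` by `bondPair_divPη_curlη` and
  `star_curlη`), `bondPair_DstarD_im` `Im ⟨A, D*D_U A⟩ = 0` (for `*`-compatible `τ`), hence **`deltaPrime_re_le_hessPair_re`**
  `Re ⟨A,Δ′A⟩ ≤ Re ⟨A,ΔA⟩`: in (3.10) `Δ = D*D + Δ′` the principal part is a positive form and `Δ′` is the (small, §3) remainder —
  the sense of «treated as a small perturbation of D*D».
* §5 sanity: `Through` is inhabited (`μ < ν ⟹ p_{μν}(x) ∈ st(⟨x,x+e_μ⟩)`), every plaquette through `b` is positively oriented, and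
  for the trivial background `U ≡ 1`: `U(∂p) = 1`, so `ε = 0` is admissible and (3.69) gives `Δ′ = 0`-consistent bound `≤ 0`.

RELATED IN THE TREE, NOT DUPLICATED (searched 2026-08-19: `grep -rln "3.69\|st(b)\|Re U(∂p)" Balaban1983to89/`, MODULE-MAP rows
B8/B9/B10): `B9Eq310Hermitian.norm_deltaPrimeOp_le` (this lineage) = the GLOBAL form with `δ` a hypothesis on ALL positively
oriented plaquettes and `ρ = 1` — re-derived here from the local theorem; `B9Eq335Plaquette` (b09) proves (3.35) ⟹ B7 (52):
`‖e^{X₁}e^{X₂}e^{−X₃}e^{−X₄} − 1‖ ≤ 2C(1+C)e^{4C}ξ²` in a complete normed algebra from `‖X_i‖ ≤ Cξ`, `‖X₁ − X₃‖, ‖X₂ − X₄‖ ≤ Cξ²`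
— the SOURCE of this file's hypothesis `ε = C′ξ²` for `U′ = 1` (its carrier is four abstract exponentials, ours the units
`U μ x`; composing the two is the reader's one-line instantiation, not done here to keep the import cone at `B9Eq310Hermitian`);
`B8FromB9` (r1) QUOTES (3.69) with `U′ = 1` as hypothesis (Q3) and does the weighted-norm bookkeeping `weighted_369_pointwise`;
`B10Eq61PerSite`/`B10Eq61Leaves` (b10) quote (3.69) for the analyticity-domain constants; `B9Thm311Data`/`B9Thm311Lattice` (b09)
take positivity of an ABSTRACT `Δ` as the hypothesis `hΔnn` in a real finite-dimensional model — §4 here proves positivity of the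
actual `D*D_U` part of (3.10) in the trace-pairing model (no instance of their carrier is built).  Nothing in the tree derives
(3.69) from (3.10), types `st(b)`, or bounds `Re U(∂p) − 1`, `Im U(∂p)` by `U(∂p) − 1`.

NOT PROVED HERE, NOT CLAIMED: the smallness of `Δ′` RELATIVE TO `D*D` as forms or in `L²`-operator norm (`|⟨B,Δ′A⟩| ≤ cδ‖A‖₂‖B‖₂`
needs a Hilbert structure for `τ`, i.e. Cauchy–Schwarz for `τ(a*b)` — not assumed; what is proved is the sup-norm operator bound
(3.69) and `D*D ≥ 0`); Theorem 3.11 / any lower bound on `Δ` (b09 `B9Thm311*`); the regularity conditions (3.35)–(3.38) ⟹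
`‖(U′U)(∂p) − 1‖ ≤ O(1)(Mα₀ + α₁)ξ²` (for `U′ = 1` see `B9Eq335Plaquette`; for `U′ ≠ 1` not in the tree); the sentence on
`Δ′(U′U) − Δ′(U)` («additional factor α₁»); (3.70) and everything after it; any statement in the normalised Hilbert–Schmidt norm
of p. 392 (cell DIVERGENCE D-1); the identification of `(S, T, ι)` with `T_η`, of `Through` with the print's `st(b)` beyond the
displayed formula, and of `τ` with the matrix trace is the reader's (DIVERGENCE D-pv27.6).  Records: GAPS C-pv27-70.  NOT summit
progress.
-/

noncomputable section

open NormedSpace Complex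

namespace Literature.MathematicalPhysics.QuantumFieldTheory.Balaban1983to89.B9Eq369Small

open Literature.MathematicalPhysics.QuantumFieldTheory.Balaban1983to89.Beta.TransportVertices
open Literature.MathematicalPhysics.QuantumFieldTheory.Balaban1983to89.B9Eq37Insertion
open Literature.MathematicalPhysics.QuantumFieldTheory.Balaban1983to89.B9Eq39Adjoint
open Literature.MathematicalPhysics.QuantumFieldTheory.Balaban1983to89.B9Eq310Hermitian

/-! ## §1  The display below (3.69): `Re W − 1`, `Im W` are controlled by `W − 1` -/

section ReImAlgebra

variable {𝔸 : Type*} [Ring 𝔸] [Algebra ℂ 𝔸]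

omit [Algebra ℂ 𝔸] in
/-- `W⁻¹ − 1 = W⁻¹(1 − W)` for a unit `W`. [folklore] -/
theorem inv_sub_one_eq (W : 𝔸ˣ) : ((W⁻¹ : 𝔸ˣ) : 𝔸) - 1 = ((W⁻¹ : 𝔸ˣ) : 𝔸) * (1 - (W : 𝔸)) := by
  rw [mul_sub, mul_one, Units.inv_mul]

/-- `½(1 + 1) = 1` in a ℂ-algebra, as a scalar action. [folklore] -/
theorem half_smul_one_add_one : (2 : ℂ)⁻¹ • ((1 : 𝔸) + 1) = 1 := by
  rw [← two_smul ℂ (1 : 𝔸), smul_smul, inv_mul_cancel₀ two_ne_zero, one_smul]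

/-- `Re W − 1 = ½((W − 1) + (W⁻¹ − 1))` for the complexified `Re W = ½(W + W⁻¹)` of p. 391 (`B9Eq37Insertion.reC`). [folklore]
[cite: Balaban1985BackgroundPropagators, after (3.7) p.391; p.404 below (3.69)] -/
theorem reC_sub_one_eq (W : 𝔸ˣ) :
    reC W - 1 = (2 : ℂ)⁻¹ • (((W : 𝔸) - 1) + (((W⁻¹ : 𝔸ˣ) : 𝔸) - 1)) := by
  have e : ((W : 𝔸) - 1) + (((W⁻¹ : 𝔸ˣ) : 𝔸) - 1) = ((W : 𝔸) + ((W⁻¹ : 𝔸ˣ) : 𝔸)) - ((1 : 𝔸) + 1) := by abel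
  rw [reC, e, smul_sub, half_smul_one_add_one]

/-- … `= −½(W − 1)(W⁻¹ − 1)`: `Re W − 1` is of SECOND order in `W − 1`. [folklore] -/
theorem reC_sub_one_eq_mul (W : 𝔸ˣ) :
    reC W - 1 = -((2 : ℂ)⁻¹ • (((W : 𝔸) - 1) * (((W⁻¹ : 𝔸ˣ) : 𝔸) - 1))) := by
  have e : ((W : 𝔸) - 1) * (((W⁻¹ : 𝔸ˣ) : 𝔸) - 1) = -(((W : 𝔸) - 1) + (((W⁻¹ : 𝔸ˣ) : 𝔸) - 1)) := by
    simp only [sub_mul, mul_sub, mul_one, one_mul, Units.mul_inv]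
    abel
  rw [reC_sub_one_eq, e, smul_neg, neg_neg]

/-- `Im W = −(i/2)((W − 1) − (W⁻¹ − 1))` for the complexified `Im W = (2i)⁻¹(W − W⁻¹)` (`B9Eq37Insertion.imC`). [folklore]
[cite: Balaban1985BackgroundPropagators, after (3.7) p.391; p.404 below (3.69)] -/
theorem imC_eq_sub (W : 𝔸ˣ) : imC W = (-(I / 2)) • (((W : 𝔸) - 1) - (((W⁻¹ : 𝔸ˣ) : 𝔸) - 1)) := by
  rw [imC_eq, sub_sub_sub_cancel_right]

end ReImAlgebra

section ReImNorm

variable {𝔸 : Type*} [NormedRing 𝔸] [NormedAlgebra ℂ 𝔸]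

omit [NormedAlgebra ℂ 𝔸] in
/-- `‖W⁻¹ − 1‖ ≤ r‖W − 1‖` when `‖W⁻¹‖ ≤ r`. [folklore] -/
theorem norm_inv_sub_one_le {W : 𝔸ˣ} {r : ℝ} (hr : ‖((W⁻¹ : 𝔸ˣ) : 𝔸)‖ ≤ r) :
    ‖((W⁻¹ : 𝔸ˣ) : 𝔸) - 1‖ ≤ r * ‖(W : 𝔸) - 1‖ := by
  rw [inv_sub_one_eq]
  calc ‖((W⁻¹ : 𝔸ˣ) : 𝔸) * (1 - (W : 𝔸))‖ ≤ ‖((W⁻¹ : 𝔸ˣ) : 𝔸)‖ * ‖1 - (W : 𝔸)‖ := norm_mul_le _ _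
    _ = ‖((W⁻¹ : 𝔸ˣ) : 𝔸)‖ * ‖(W : 𝔸) - 1‖ := by rw [norm_sub_rev]
    _ ≤ r * ‖(W : 𝔸) - 1‖ := mul_le_mul_of_nonneg_right hr (norm_nonneg _)

/-- `‖½‖ = ½` in `ℂ`. [folklore] -/
theorem norm_two_inv : ‖(2 : ℂ)⁻¹‖ = 2⁻¹ := by rw [norm_inv, Complex.norm_two]

/-- `‖−i/2‖ = ½` in `ℂ`. [folklore] -/
theorem norm_neg_I_div_two : ‖-(I / 2)‖ = 2⁻¹ := by
  rw [norm_neg, norm_div, Complex.norm_I, Complex.norm_two, one_div]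

/-- **`|Re W − 1| ≤ ½(1 + r)|W − 1|`** for `‖W⁻¹‖ ≤ r` — the display below (3.69), real part. [folklore]
[cite: Balaban1985BackgroundPropagators, p.404 below (3.69)] -/
theorem norm_reC_sub_one_le {W : 𝔸ˣ} {r : ℝ} (hr : ‖((W⁻¹ : 𝔸ˣ) : 𝔸)‖ ≤ r) :
    ‖reC W - 1‖ ≤ (1 + r) / 2 * ‖(W : 𝔸) - 1‖ := by
  have e : ‖((W : 𝔸) - 1) + (((W⁻¹ : 𝔸ˣ) : 𝔸) - 1)‖ ≤ ‖(W : 𝔸) - 1‖ + r * ‖(W : 𝔸) - 1‖ :=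
    norm_add_le_of_le le_rfl (norm_inv_sub_one_le hr)
  rw [reC_sub_one_eq, norm_smul, norm_two_inv]
  calc 2⁻¹ * ‖((W : 𝔸) - 1) + (((W⁻¹ : 𝔸ˣ) : 𝔸) - 1)‖ ≤ 2⁻¹ * (‖(W : 𝔸) - 1‖ + r * ‖(W : 𝔸) - 1‖) := by
        gcongr
    _ = (1 + r) / 2 * ‖(W : 𝔸) - 1‖ := by ring

/-- … and the second-order version `|Re W − 1| ≤ (r/2)|W − 1|²`. [folklore] -/
theorem norm_reC_sub_one_le_sq {W : 𝔸ˣ} {r : ℝ} (hr : ‖((W⁻¹ : 𝔸ˣ) : 𝔸)‖ ≤ r) :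
    ‖reC W - 1‖ ≤ r / 2 * ‖(W : 𝔸) - 1‖ ^ 2 := by
  have e : ‖((W : 𝔸) - 1) * (((W⁻¹ : 𝔸ˣ) : 𝔸) - 1)‖ ≤ ‖(W : 𝔸) - 1‖ * (r * ‖(W : 𝔸) - 1‖) :=
    norm_mul_le_of_le le_rfl (norm_inv_sub_one_le hr)
  rw [reC_sub_one_eq_mul, norm_neg, norm_smul, norm_two_inv]
  calc 2⁻¹ * ‖((W : 𝔸) - 1) * (((W⁻¹ : 𝔸ˣ) : 𝔸) - 1)‖ ≤ 2⁻¹ * (‖(W : 𝔸) - 1‖ * (r * ‖(W : 𝔸) - 1‖)) := by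
        gcongr
    _ = r / 2 * ‖(W : 𝔸) - 1‖ ^ 2 := by ring

/-- **`|Im W| ≤ ½(1 + r)|W − 1|`** for `‖W⁻¹‖ ≤ r` — the display below (3.69), imaginary part. [folklore]
[cite: Balaban1985BackgroundPropagators, p.404 below (3.69)] -/
theorem norm_imC_le {W : 𝔸ˣ} {r : ℝ} (hr : ‖((W⁻¹ : 𝔸ˣ) : 𝔸)‖ ≤ r) :
    ‖imC W‖ ≤ (1 + r) / 2 * ‖(W : 𝔸) - 1‖ := by
  have e : ‖((W : 𝔸) - 1) - (((W⁻¹ : 𝔸ˣ) : 𝔸) - 1)‖ ≤ ‖(W : 𝔸) - 1‖ + r * ‖(W : 𝔸) - 1‖ :=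
    norm_sub_le_of_le le_rfl (norm_inv_sub_one_le hr)
  rw [imC_eq_sub, norm_smul, norm_neg_I_div_two]
  calc 2⁻¹ * ‖((W : 𝔸) - 1) - (((W⁻¹ : 𝔸ˣ) : 𝔸) - 1)‖ ≤ 2⁻¹ * (‖(W : 𝔸) - 1‖ + r * ‖(W : 𝔸) - 1‖) := by
        gcongr
    _ = (1 + r) / 2 * ‖(W : 𝔸) - 1‖ := by ring

/-- On the group (`‖W⁻¹‖ ≤ 1`, e.g. a unitary matrix in the operator norm): `|Re W − 1| ≤ |W − 1|`. [folklore]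
[cite: Balaban1985BackgroundPropagators, p.404 below (3.69)] -/
theorem norm_reC_sub_one_le_one {W : 𝔸ˣ} (h1 : ‖((W⁻¹ : 𝔸ˣ) : 𝔸)‖ ≤ 1) : ‖reC W - 1‖ ≤ ‖(W : 𝔸) - 1‖ :=
  (norm_reC_sub_one_le h1).trans (le_of_eq (by ring))

/-- On the group: `|Im W| ≤ |W − 1|`. [folklore] [cite: Balaban1985BackgroundPropagators, p.404 below (3.69)] -/
theorem norm_imC_le_one {W : 𝔸ˣ} (h1 : ‖((W⁻¹ : 𝔸ˣ) : 𝔸)‖ ≤ 1) : ‖imC W‖ ≤ ‖(W : 𝔸) - 1‖ :=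
  (norm_imC_le h1).trans (le_of_eq (by ring))

/-- On the group, second order: `|Re W − 1| ≤ ½|W − 1|²`. [folklore] -/
theorem norm_reC_sub_one_le_half_sq {W : 𝔸ˣ} (h1 : ‖((W⁻¹ : 𝔸ˣ) : 𝔸)‖ ≤ 1) :
    ‖reC W - 1‖ ≤ 2⁻¹ * ‖(W : 𝔸) - 1‖ ^ 2 :=
  (norm_reC_sub_one_le_sq h1).trans (le_of_eq (by ring))

end ReImNorm

/-! ## §2  The plaquette weights `z(p) = η⁻²(Re U(∂p) − 1)`, `y(p) = η⁻² Im U(∂p)` are small when `U(∂p) − 1` is -/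

section Plaquette

variable {𝔸 : Type*} [NormedRing 𝔸] [NormedAlgebra ℂ 𝔸] {S : Type*} {ι : Type*}
variable (T : ι → Equiv.Perm S) (U : ι → S → 𝔸ˣ)

omit [NormedAlgebra ℂ 𝔸] in
/-- `U(∂p)⁻¹ = U_ν(y)·U_κ(y+e_ν)·U_ν(y+e_κ)⁻¹·U_κ(y)⁻¹` — the plaquette variable of the reversed contour. [folklore]
[cite: Balaban1985BackgroundPropagators, (3.5) p.391] -/
theorem plaqU_inv_val (κ ν : ι) (y : S) :
    (((plaqU T U κ ν y)⁻¹ : 𝔸ˣ) : 𝔸)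
      = (U ν y : 𝔸) * (U κ (T ν y) : 𝔸) * (((U ν (T κ y))⁻¹ : 𝔸ˣ) : 𝔸) * (((U κ y)⁻¹ : 𝔸ˣ) : 𝔸) := by
  simp only [plaqU, mul_inv_rev, inv_inv, Units.val_mul, mul_assoc]

omit [NormedAlgebra ℂ 𝔸] in
/-- `‖U(∂p)‖ ≤ ρ⁴` for bond variables with `‖U(b)‖, ‖U(b)⁻¹‖ ≤ ρ`. [folklore] -/
theorem norm_plaqU_le {ρ : ℝ} (hUρ : ∀ μ x, ‖(U μ x : 𝔸)‖ ≤ ρ ∧ ‖(((U μ x)⁻¹ : 𝔸ˣ) : 𝔸)‖ ≤ ρ) (κ ν : ι) (y : S) :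
    ‖(plaqU T U κ ν y : 𝔸)‖ ≤ ρ ^ 4 := by
  unfold plaqU
  rw [Units.val_mul, Units.val_mul, Units.val_mul]
  calc ‖(U κ y : 𝔸) * (U ν (T κ y) : 𝔸) * (((U κ (T ν y))⁻¹ : 𝔸ˣ) : 𝔸) * (((U ν y)⁻¹ : 𝔸ˣ) : 𝔸)‖
      ≤ ρ * ρ * ρ * ρ :=
        norm_mul_le_of_le (norm_mul_le_of_le (norm_mul_le_of_le (hUρ _ _).1 (hUρ _ _).1) (hUρ _ _).2) (hUρ _ _).2
    _ = ρ ^ 4 := by ring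

omit [NormedAlgebra ℂ 𝔸] in
/-- `‖U(∂p)⁻¹‖ ≤ ρ⁴` likewise. [folklore] -/
theorem norm_plaqU_inv_le {ρ : ℝ} (hUρ : ∀ μ x, ‖(U μ x : 𝔸)‖ ≤ ρ ∧ ‖(((U μ x)⁻¹ : 𝔸ˣ) : 𝔸)‖ ≤ ρ) (κ ν : ι)
    (y : S) : ‖(((plaqU T U κ ν y)⁻¹ : 𝔸ˣ) : 𝔸)‖ ≤ ρ ^ 4 := by
  rw [plaqU_inv_val]
  calc ‖(U ν y : 𝔸) * (U κ (T ν y) : 𝔸) * (((U ν (T κ y))⁻¹ : 𝔸ˣ) : 𝔸) * (((U κ y)⁻¹ : 𝔸ˣ) : 𝔸)‖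
      ≤ ρ * ρ * ρ * ρ :=
        norm_mul_le_of_le (norm_mul_le_of_le (norm_mul_le_of_le (hUρ _ _).1 (hUρ _ _).1) (hUρ _ _).2) (hUρ _ _).2
    _ = ρ ^ 4 := by ring

omit [NormedAlgebra ℂ 𝔸] in
/-- On the group (`ρ = 1`): `‖U(∂p)⁻¹‖ ≤ 1`. [folklore] -/
theorem norm_plaqU_inv_le_one (hU1 : ∀ μ x, ‖(U μ x : 𝔸)‖ ≤ 1 ∧ ‖(((U μ x)⁻¹ : 𝔸ˣ) : 𝔸)‖ ≤ 1) (κ ν : ι) (y : S) :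
    ‖(((plaqU T U κ ν y)⁻¹ : 𝔸ˣ) : 𝔸)‖ ≤ 1 :=
  (norm_plaqU_inv_le T U hU1 κ ν y).trans (le_of_eq (by norm_num))

/-- `‖(η⁻¹)²‖ = (η²)⁻¹` for the complexified scalar `η⁻¹`. [folklore] -/
theorem norm_eta_inv_sq (η : ℝ) : ‖((η : ℂ)⁻¹) ^ 2‖ = (η ^ 2)⁻¹ := by
  rw [norm_pow, norm_inv, Complex.norm_real, Real.norm_eq_abs, inv_pow, sq_abs]

/-- **SMALLNESS OF `z(p)`**: `‖U(∂p)⁻¹‖ ≤ r` and `‖U(∂p) − 1‖ ≤ ε` ⟹ `‖z(p)‖ = η⁻²‖Re U(∂p) − 1‖ ≤ (η²)⁻¹·½(1 + r)·ε`. [folklore]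
[cite: Balaban1985BackgroundPropagators, p.404 below (3.69); (3.10) p.392] -/
theorem norm_zP_le_of_plaq {η ε r : ℝ} {κ ν : ι} {y : S} (hr : ‖(((plaqU T U κ ν y)⁻¹ : 𝔸ˣ) : 𝔸)‖ ≤ r)
    (hε : ‖(plaqU T U κ ν y : 𝔸) - 1‖ ≤ ε) : ‖zP T U η κ ν y‖ ≤ (η ^ 2)⁻¹ * ((1 + r) / 2 * ε) := by
  have h0 : 0 ≤ (1 + r) / 2 := by have := (norm_nonneg _).trans hr; positivity
  unfold zP
  rw [norm_smul, norm_eta_inv_sq]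
  exact mul_le_mul_of_nonneg_left ((norm_reC_sub_one_le hr).trans (mul_le_mul_of_nonneg_left hε h0))
    (inv_nonneg.mpr (sq_nonneg η))

/-- **SMALLNESS OF `y(p)`**: `‖U(∂p)⁻¹‖ ≤ r` and `‖U(∂p) − 1‖ ≤ ε` ⟹ `‖y(p)‖ = η⁻²‖Im U(∂p)‖ ≤ (η²)⁻¹·½(1 + r)·ε`. [folklore]
[cite: Balaban1985BackgroundPropagators, p.404 below (3.69); (3.10) p.392] -/
theorem norm_yP_le_of_plaq {η ε r : ℝ} {κ ν : ι} {y : S} (hr : ‖(((plaqU T U κ ν y)⁻¹ : 𝔸ˣ) : 𝔸)‖ ≤ r)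
    (hε : ‖(plaqU T U κ ν y : 𝔸) - 1‖ ≤ ε) : ‖yP T U η κ ν y‖ ≤ (η ^ 2)⁻¹ * ((1 + r) / 2 * ε) := by
  have h0 : 0 ≤ (1 + r) / 2 := by have := (norm_nonneg _).trans hr; positivity
  unfold yP
  rw [norm_smul, norm_eta_inv_sq]
  exact mul_le_mul_of_nonneg_left ((norm_imC_le hr).trans (mul_le_mul_of_nonneg_left hε h0))
    (inv_nonneg.mpr (sq_nonneg η))

/-- On the group: `‖U(∂p) − 1‖ ≤ ε` ⟹ `‖z(p)‖ ≤ (η²)⁻¹ε`. [folklore] [cite: Balaban1985BackgroundPropagators, p.404 below (3.69)] -/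
theorem norm_zP_le_of_plaq_one (hU1 : ∀ μ x, ‖(U μ x : 𝔸)‖ ≤ 1 ∧ ‖(((U μ x)⁻¹ : 𝔸ˣ) : 𝔸)‖ ≤ 1) {η ε : ℝ}
    {κ ν : ι} {y : S} (hε : ‖(plaqU T U κ ν y : 𝔸) - 1‖ ≤ ε) : ‖zP T U η κ ν y‖ ≤ (η ^ 2)⁻¹ * ε :=
  (norm_zP_le_of_plaq T U (norm_plaqU_inv_le_one T U hU1 κ ν y) hε).trans (le_of_eq (by ring))

/-- On the group: `‖U(∂p) − 1‖ ≤ ε` ⟹ `‖y(p)‖ ≤ (η²)⁻¹ε`. [folklore] [cite: Balaban1985BackgroundPropagators, p.404 below (3.69)] -/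
theorem norm_yP_le_of_plaq_one (hU1 : ∀ μ x, ‖(U μ x : 𝔸)‖ ≤ 1 ∧ ‖(((U μ x)⁻¹ : 𝔸ˣ) : 𝔸)‖ ≤ 1) {η ε : ℝ}
    {κ ν : ι} {y : S} (hε : ‖(plaqU T U κ ν y : 𝔸) - 1‖ ≤ ε) : ‖yP T U η κ ν y‖ ≤ (η ^ 2)⁻¹ * ε :=
  (norm_yP_le_of_plaq T U (norm_plaqU_inv_le_one T U hU1 κ ν y) hε).trans (le_of_eq (by ring))

end Plaquette

/-! ## §3  (3.69): the LOCAL bound on `(Δ′A)(b)` over the plaquettes through `b` -/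

section Local

variable {𝔸 : Type*} [NormedRing 𝔸] [NormedAlgebra ℂ 𝔸] {S : Type*} {ι : Type*}
variable (T : ι → Equiv.Perm S) (U : ι → S → 𝔸ˣ)

/-- **THE PLAQUETTES THROUGH A BOND** (`st(b)` of p. 404, in the orientation convention of (3.9)): `Through T μ x κ ν y` says that
the positively oriented plaquette `p_{κν}(y)` (`κ < ν`) has the bond `b = ⟨x, x+e_μ⟩` on its boundary — either `ν = μ` and
`y ∈ {x, x − e_κ}` (then `b` is the bond `(ν,y)` resp. `(ν, y+e_κ)` of `∂p`) or `κ = μ` and `y ∈ {x, x − e_ν}` (then `b` is `(κ,y)`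
resp. `(κ, y+e_ν)`).  These are exactly the plaquettes the sums `Σ_{ν<μ}`, `Σ_{ν>μ}` of (3.9) (`divP`, `divL`) at `b` run over
(`deltaPrimeOp_congr_local`). [folklore] [cite: Balaban1985BackgroundPropagators, p.404 after (3.69); (3.9) p.392] -/
def Through [LT ι] (μ : ι) (x : S) (κ ν : ι) (y : S) : Prop :=
  κ < ν ∧ ((ν = μ ∧ (y = x ∨ y = (T κ).symm x)) ∨ (κ = μ ∧ (y = x ∨ y = (T ν).symm x)))

omit [NormedAlgebra ℂ 𝔸] in
/-- Transport by a unit with `‖W‖, ‖W⁻¹‖ ≤ ρ`: `‖R(W)X‖ ≤ ρ²‖X‖`. [folklore] -/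
theorem norm_R_le_rho {W : 𝔸ˣ} {ρ : ℝ} (h₁ : ‖(W : 𝔸)‖ ≤ ρ) (h₂ : ‖((W⁻¹ : 𝔸ˣ) : 𝔸)‖ ≤ ρ) (X : 𝔸) :
    ‖R W X‖ ≤ ρ ^ 2 * ‖X‖ := by
  unfold R
  calc ‖(W : 𝔸) * X * ((W⁻¹ : 𝔸ˣ) : 𝔸)‖ ≤ ρ * ‖X‖ * ρ := norm_mul_le_of_le (norm_mul_le_of_le h₁ le_rfl) h₂
    _ = ρ ^ 2 * ‖X‖ := by ring

omit [NormedAlgebra ℂ 𝔸] in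
/-- … and by its inverse. [folklore] -/
theorem norm_R_inv_le_rho {W : 𝔸ˣ} {ρ : ℝ} (h₁ : ‖(W : 𝔸)‖ ≤ ρ) (h₂ : ‖((W⁻¹ : 𝔸ˣ) : 𝔸)‖ ≤ ρ) (X : 𝔸) :
    ‖R W⁻¹ X‖ ≤ ρ ^ 2 * ‖X‖ :=
  norm_R_le_rho h₂ (by rw [inv_inv]; exact h₁) X

/-- `a ≤ ρ²a` for `1 ≤ ρ`, `0 ≤ a`. [folklore] -/
theorem le_rho_sq_mul {ρ a : ℝ} (hρ : 1 ≤ ρ) (ha : 0 ≤ a) : a ≤ ρ ^ 2 * a :=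
  le_mul_of_one_le_left ha (by nlinarith)

omit [NormedAlgebra ℂ 𝔸] in
/-- LOCAL `‖(D_U A)(p)‖ ≤ 4ρ²a` for `p = p_{κν}(y)`, from `‖A‖ ≤ a` on the four boundary bonds `(κ,y)`, `(ν,y+e_κ)`, `(κ,y+e_ν)`,
`(ν,y)` of `p` only. [folklore] [cite: Balaban1985BackgroundPropagators, (3.4) p.391] -/
theorem norm_curl_le_loc {ρ : ℝ} (hρ : 1 ≤ ρ) (hUρ : ∀ μ x, ‖(U μ x : 𝔸)‖ ≤ ρ ∧ ‖(((U μ x)⁻¹ : 𝔸ˣ) : 𝔸)‖ ≤ ρ)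
    {A : ι → S → 𝔸} {a : ℝ} {κ ν : ι} {y : S} (h₁ : ‖A κ y‖ ≤ a) (h₂ : ‖A ν (T κ y)‖ ≤ a) (h₃ : ‖A κ (T ν y)‖ ≤ a)
    (h₄ : ‖A ν y‖ ≤ a) : ‖curl T U A κ ν y‖ ≤ 4 * ρ ^ 2 * a := by
  have ha : 0 ≤ a := (norm_nonneg _).trans h₁
  have e₂ : ‖R (U κ y) (A ν (T κ y))‖ ≤ ρ ^ 2 * a :=
    (norm_R_le_rho (hUρ κ y).1 (hUρ κ y).2 _).trans (mul_le_mul_of_nonneg_left h₂ (sq_nonneg ρ))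
  have e₃ : ‖R (U ν y) (A κ (T ν y))‖ ≤ ρ ^ 2 * a :=
    (norm_R_le_rho (hUρ ν y).1 (hUρ ν y).2 _).trans (mul_le_mul_of_nonneg_left h₃ (sq_nonneg ρ))
  have e₁ : ‖A κ y‖ ≤ ρ ^ 2 * a := h₁.trans (le_rho_sq_mul hρ ha)
  have e₄ : ‖A ν y‖ ≤ ρ ^ 2 * a := h₄.trans (le_rho_sq_mul hρ ha)
  unfold curl covD
  exact (norm_sub_le_of_le (norm_sub_le_of_le e₂ e₄) (norm_sub_le_of_le e₃ e₁)).trans (le_of_eq (by ring))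

omit [NormedAlgebra ℂ 𝔸] in
/-- LOCAL `‖S_k(p)‖ ≤ 3ρ²a` for the signed partner sums, from the same four bonds. [folklore] -/
theorem norm_sgnSum_le_loc {ρ : ℝ} (hρ : 1 ≤ ρ) (hUρ : ∀ μ x, ‖(U μ x : 𝔸)‖ ≤ ρ ∧ ‖(((U μ x)⁻¹ : 𝔸ˣ) : 𝔸)‖ ≤ ρ)
    {A : ι → S → 𝔸} {a : ℝ} {κ ν : ι} {y : S} (h₁ : ‖A κ y‖ ≤ a) (h₂ : ‖A ν (T κ y)‖ ≤ a) (h₃ : ‖A κ (T ν y)‖ ≤ a)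
    (h₄ : ‖A ν y‖ ≤ a) :
    ‖sgnSum₁ T U A κ ν y‖ ≤ 3 * ρ ^ 2 * a ∧ ‖sgnSum₂ T U A κ ν y‖ ≤ 3 * ρ ^ 2 * a
      ∧ ‖sgnSum₃ T U A κ ν y‖ ≤ 3 * ρ ^ 2 * a ∧ ‖sgnSum₄ T U A κ ν y‖ ≤ 3 * ρ ^ 2 * a := by
  have ha : 0 ≤ a := (norm_nonneg _).trans h₁
  have l₁ : ‖-(R (U ν y) (A κ (T ν y)))‖ ≤ ρ ^ 2 * a := by
    rw [norm_neg]
    exact (norm_R_le_rho (hUρ ν y).1 (hUρ ν y).2 _).trans (mul_le_mul_of_nonneg_left h₃ (sq_nonneg ρ))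
  have l₂ : ‖-(A ν y)‖ ≤ ρ ^ 2 * a := by rw [norm_neg]; exact h₄.trans (le_rho_sq_mul hρ ha)
  have l₃ : ‖A κ y‖ ≤ ρ ^ 2 * a := h₁.trans (le_rho_sq_mul hρ ha)
  have l₄ : ‖R (U κ y) (A ν (T κ y))‖ ≤ ρ ^ 2 * a :=
    (norm_R_le_rho (hUρ κ y).1 (hUρ κ y).2 _).trans (mul_le_mul_of_nonneg_left h₂ (sq_nonneg ρ))
  refine ⟨?_, ?_, ?_, ?_⟩
  · rw [sgnSum₁, norm_neg]
    exact (norm_add_le_of_le (norm_add_le_of_le l₂ l₃) l₄).trans (le_of_eq (by ring))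
  · exact (norm_sub_le_of_le l₁ (norm_add_le_of_le l₃ l₄)).trans (le_of_eq (by ring))
  · exact (norm_sub_le_of_le (norm_add_le_of_le l₁ l₂) l₄).trans (le_of_eq (by ring))
  · exact (norm_add_le_of_le (norm_add_le_of_le l₁ l₂) l₃).trans (le_of_eq (by ring))

/-- LOCAL `‖F^J_A(p)‖ ≤ 4ρ²a·δ` from the four bonds of `p` and `‖z(p)‖ ≤ δ`. [folklore]
[cite: Balaban1985BackgroundPropagators, (3.10) p.392] -/
theorem norm_jordanF_le_loc {ρ : ℝ} (hρ : 1 ≤ ρ) (hUρ : ∀ μ x, ‖(U μ x : 𝔸)‖ ≤ ρ ∧ ‖(((U μ x)⁻¹ : 𝔸ˣ) : 𝔸)‖ ≤ ρ)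
    {A : ι → S → 𝔸} {a : ℝ} {κ ν : ι} {y : S} (h₁ : ‖A κ y‖ ≤ a) (h₂ : ‖A ν (T κ y)‖ ≤ a) (h₃ : ‖A κ (T ν y)‖ ≤ a)
    (h₄ : ‖A ν y‖ ≤ a) {η δ : ℝ} (hz : ‖zP T U η κ ν y‖ ≤ δ) : ‖jordanF T U η A κ ν y‖ ≤ 4 * ρ ^ 2 * a * δ :=
  norm_jordan_smul_le (norm_curl_le_loc T U hρ hUρ h₁ h₂ h₃ h₄) hz

/-- LOCAL `‖(G_k)_A(p)‖ ≤ 3ρ²a·δ` from the four bonds of `p` and `‖y(p)‖ ≤ δ`. [folklore]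
[cite: Balaban1985BackgroundPropagators, (3.10) p.392] -/
theorem norm_commG_le_loc {ρ : ℝ} (hρ : 1 ≤ ρ) (hUρ : ∀ μ x, ‖(U μ x : 𝔸)‖ ≤ ρ ∧ ‖(((U μ x)⁻¹ : 𝔸ˣ) : 𝔸)‖ ≤ ρ)
    {A : ι → S → 𝔸} {a : ℝ} {κ ν : ι} {y : S} (h₁ : ‖A κ y‖ ≤ a) (h₂ : ‖A ν (T κ y)‖ ≤ a) (h₃ : ‖A κ (T ν y)‖ ≤ a)
    (h₄ : ‖A ν y‖ ≤ a) {η δ : ℝ} (hy : ‖yP T U η κ ν y‖ ≤ δ) :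
    ‖commG₁ T U η A κ ν y‖ ≤ 3 * ρ ^ 2 * a * δ ∧ ‖commG₂ T U η A κ ν y‖ ≤ 3 * ρ ^ 2 * a * δ
      ∧ ‖commG₃ T U η A κ ν y‖ ≤ 3 * ρ ^ 2 * a * δ ∧ ‖commG₄ T U η A κ ν y‖ ≤ 3 * ρ ^ 2 * a * δ := by
  obtain ⟨l₁, l₂, l₃, l₄⟩ := norm_sgnSum_le_loc T U hρ hUρ h₁ h₂ h₃ h₄
  exact ⟨norm_comm_smul_le l₁ hy, norm_comm_smul_le l₂ hy, norm_comm_smul_le l₃ hy, norm_comm_smul_le l₄ hy⟩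

variable [Fintype ι] [LinearOrder ι]

omit [NormedAlgebra ℂ 𝔸] in
/-- LOCAL `‖(÷G)(b)‖ ≤ 2ρ²g(d − 1)` from `‖G_k(p)‖ ≤ g` on the plaquettes THROUGH `b` only. [folklore]
[cite: Balaban1985BackgroundPropagators, (3.9) p.392] -/
theorem norm_divL_le_loc {ρ : ℝ} (hρ : 1 ≤ ρ) (hUρ : ∀ μ x, ‖(U μ x : 𝔸)‖ ≤ ρ ∧ ‖(((U μ x)⁻¹ : 𝔸ˣ) : 𝔸)‖ ≤ ρ)
    {G₁ G₂ G₃ G₄ : ι → ι → S → 𝔸} {g : ℝ} (μ : ι) (x : S)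
    (hG : ∀ κ ν y, Through T μ x κ ν y → ‖G₁ κ ν y‖ ≤ g ∧ ‖G₂ κ ν y‖ ≤ g ∧ ‖G₃ κ ν y‖ ≤ g ∧ ‖G₄ κ ν y‖ ≤ g) :
    ‖divL T U G₁ G₂ G₃ G₄ μ x‖ ≤ 2 * ρ ^ 2 * g * ((Fintype.card ι - 1 : ℕ) : ℝ) := by
  have h1 : ∀ ν, ‖(if ν < μ then R (U ν ((T ν).symm x))⁻¹ (G₄ ν μ ((T ν).symm x)) - G₂ ν μ x else 0)‖
      ≤ if ν < μ then 2 * ρ ^ 2 * g else 0 := by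
    intro ν
    split_ifs with h
    · have t₁ : Through T μ x ν μ ((T ν).symm x) := ⟨h, Or.inl ⟨rfl, Or.inr rfl⟩⟩
      have t₂ : Through T μ x ν μ x := ⟨h, Or.inl ⟨rfl, Or.inl rfl⟩⟩
      have hg : 0 ≤ g := (norm_nonneg _).trans (hG _ _ _ t₂).2.1
      exact (norm_sub_le_of_le ((norm_R_inv_le_rho (hUρ _ _).1 (hUρ _ _).2 _).trans
        (mul_le_mul_of_nonneg_left (hG _ _ _ t₁).2.2.2 (sq_nonneg ρ)))
        (((hG _ _ _ t₂).2.1).trans (le_rho_sq_mul hρ hg))).trans (le_of_eq (by ring))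
    · rw [norm_zero]
  have h2 : ∀ ν, ‖(if μ < ν then R (U ν ((T ν).symm x))⁻¹ (G₁ μ ν ((T ν).symm x)) - G₃ μ ν x else 0)‖
      ≤ if μ < ν then 2 * ρ ^ 2 * g else 0 := by
    intro ν
    split_ifs with h
    · have t₁ : Through T μ x μ ν ((T ν).symm x) := ⟨h, Or.inr ⟨rfl, Or.inr rfl⟩⟩
      have t₂ : Through T μ x μ ν x := ⟨h, Or.inr ⟨rfl, Or.inl rfl⟩⟩
      have hg : 0 ≤ g := (norm_nonneg _).trans (hG _ _ _ t₂).2.2.1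
      exact (norm_sub_le_of_le ((norm_R_inv_le_rho (hUρ _ _).1 (hUρ _ _).2 _).trans
        (mul_le_mul_of_nonneg_left (hG _ _ _ t₁).1 (sq_nonneg ρ)))
        (((hG _ _ _ t₂).2.2.1).trans (le_rho_sq_mul hρ hg))).trans (le_of_eq (by ring))
    · rw [norm_zero]
  unfold divL
  refine (norm_sub_le _ _).trans ?_
  refine (add_le_add ((norm_sum_le _ _).trans (Finset.sum_le_sum fun ν _ => h1 ν))
    ((norm_sum_le _ _).trans (Finset.sum_le_sum fun ν _ => h2 ν))).trans ?_
  rw [sum_ite_lt_add_sum_ite_gt μ (2 * ρ ^ 2 * g)]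

/-- **(3.69), LOCAL OPERATOR BOUND.**  If the bond variables satisfy `‖U(b′)‖, ‖U(b′)⁻¹‖ ≤ ρ` (`1 ≤ ρ`), and on every positively
oriented plaquette `p ∈ st(b)` through the bond `b = ⟨x, x+e_μ⟩`: `‖A(b′)‖ ≤ a` for the four bonds `b′ ⊂ ∂p`, `‖z(p)‖ ≤ δ` and
`‖y(p)‖ ≤ δ` (`z(p) = η⁻²(Re U(∂p) − 1)`, `y(p) = η⁻² Im U(∂p)`), then `‖(Δ′A)(b)‖ ≤ 14ρ⁴(d − 1)·a·δ` — «|(Δ′(U′U)A′)(b)| ≤ O(1)…|A′|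
… the supremum on the right-hand side is taken over bonds belonging to one of the plaquettes containing the bond b». [folklore]
[cite: Balaban1985BackgroundPropagators, (3.69) p.404; (3.10) p.392] -/
theorem norm_deltaPrimeOp_le_local {ρ : ℝ} (hρ : 1 ≤ ρ)
    (hUρ : ∀ μ x, ‖(U μ x : 𝔸)‖ ≤ ρ ∧ ‖(((U μ x)⁻¹ : 𝔸ˣ) : 𝔸)‖ ≤ ρ) {A : ι → S → 𝔸} {η a δ : ℝ} (μ : ι) (x : S)
    (hA : ∀ κ ν y, Through T μ x κ ν y → ‖A κ y‖ ≤ a ∧ ‖A ν (T κ y)‖ ≤ a ∧ ‖A κ (T ν y)‖ ≤ a ∧ ‖A ν y‖ ≤ a)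
    (hz : ∀ κ ν y, Through T μ x κ ν y → ‖zP T U η κ ν y‖ ≤ δ)
    (hy : ∀ κ ν y, Through T μ x κ ν y → ‖yP T U η κ ν y‖ ≤ δ) :
    ‖deltaPrimeOp T U η A μ x‖ ≤ 14 * ρ ^ 4 * (a * δ) * ((Fintype.card ι - 1 : ℕ) : ℝ) := by
  have hJ : ∀ κ ν y, Through T μ x κ ν y → ‖jordanF T U η A κ ν y‖ ≤ 4 * ρ ^ 2 * a * δ ∧
      ‖jordanF T U η A κ ν y‖ ≤ 4 * ρ ^ 2 * a * δ ∧ ‖jordanF T U η A κ ν y‖ ≤ 4 * ρ ^ 2 * a * δ ∧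
      ‖jordanF T U η A κ ν y‖ ≤ 4 * ρ ^ 2 * a * δ := by
    intro κ ν y h
    obtain ⟨h₁, h₂, h₃, h₄⟩ := hA κ ν y h
    have e := norm_jordanF_le_loc T U hρ hUρ h₁ h₂ h₃ h₄ (hz κ ν y h)
    exact ⟨e, e, e, e⟩
  have hG : ∀ κ ν y, Through T μ x κ ν y → ‖commG₁ T U η A κ ν y‖ ≤ 3 * ρ ^ 2 * a * δ ∧
      ‖commG₂ T U η A κ ν y‖ ≤ 3 * ρ ^ 2 * a * δ ∧ ‖commG₃ T U η A κ ν y‖ ≤ 3 * ρ ^ 2 * a * δ ∧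
      ‖commG₄ T U η A κ ν y‖ ≤ 3 * ρ ^ 2 * a * δ := by
    intro κ ν y h
    obtain ⟨h₁, h₂, h₃, h₄⟩ := hA κ ν y h
    exact norm_commG_le_loc T U hρ hUρ h₁ h₂ h₃ h₄ (hy κ ν y h)
  unfold deltaPrimeOp
  rw [← divL_self]
  exact (norm_add_le_of_le (norm_divL_le_loc T U hρ hUρ μ x hJ) (norm_divL_le_loc T U hρ hUρ μ x hG)).trans
    (le_of_eq (by ring))

/-- (3.69) on the group (`ρ = 1`: `‖U(b′)‖, ‖U(b′)⁻¹‖ ≤ 1`): `‖(Δ′A)(b)‖ ≤ 14(d − 1)·a·δ` with the LOCAL `a`, `δ`. [folklore]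
[cite: Balaban1985BackgroundPropagators, (3.69) p.404] -/
theorem norm_deltaPrimeOp_le_local_one (hU1 : ∀ μ x, ‖(U μ x : 𝔸)‖ ≤ 1 ∧ ‖(((U μ x)⁻¹ : 𝔸ˣ) : 𝔸)‖ ≤ 1)
    {A : ι → S → 𝔸} {η a δ : ℝ} (μ : ι) (x : S)
    (hA : ∀ κ ν y, Through T μ x κ ν y → ‖A κ y‖ ≤ a ∧ ‖A ν (T κ y)‖ ≤ a ∧ ‖A κ (T ν y)‖ ≤ a ∧ ‖A ν y‖ ≤ a)
    (hz : ∀ κ ν y, Through T μ x κ ν y → ‖zP T U η κ ν y‖ ≤ δ)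
    (hy : ∀ κ ν y, Through T μ x κ ν y → ‖yP T U η κ ν y‖ ≤ δ) :
    ‖deltaPrimeOp T U η A μ x‖ ≤ 14 * (a * δ) * ((Fintype.card ι - 1 : ℕ) : ℝ) :=
  (norm_deltaPrimeOp_le_local T U le_rfl hU1 μ x hA hz hy).trans (le_of_eq (by ring))

/-- CONSISTENCY (an `example`, since the statement IS the landed `B9Eq310Hermitian.norm_deltaPrimeOp_le` and the gate's dedup
recognises the restatement): the lineage leaf's GLOBAL bound (hypotheses on all bonds and all positively oriented plaquettes) is
the local theorem with the local hypotheses read off the global ones. [folklore]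
[cite: Balaban1985BackgroundPropagators, (3.69) p.404; (3.10) p.392] -/
example (hU1 : ∀ μ x, ‖(U μ x : 𝔸)‖ ≤ 1 ∧ ‖(((U μ x)⁻¹ : 𝔸ˣ) : 𝔸)‖ ≤ 1)
    {A : ι → S → 𝔸} {a : ℝ} (hA : ∀ μ x, ‖A μ x‖ ≤ a) {η δ : ℝ}
    (hz : ∀ μ ν x, μ < ν → ‖zP T U η μ ν x‖ ≤ δ) (hy : ∀ μ ν x, μ < ν → ‖yP T U η μ ν x‖ ≤ δ) (μ : ι) (x : S) :
    ‖deltaPrimeOp T U η A μ x‖ ≤ 14 * (a * δ) * ((Fintype.card ι - 1 : ℕ) : ℝ) :=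
  norm_deltaPrimeOp_le_local_one T U hU1 μ x (fun _ _ _ _ => ⟨hA _ _, hA _ _, hA _ _, hA _ _⟩)
    (fun κ ν y h => hz κ ν y h.1) (fun κ ν y h => hy κ ν y h.1)

/-- **(3.69) FROM THE PLAQUETTE SMALLNESS, group case**: `‖U(b′)^{±1}‖ ≤ 1`, `‖U(∂p) − 1‖ ≤ ε` for `p ∈ st(b)` and `‖A(b′)‖ ≤ a` for
`b′ ⊂ ∂p`, `p ∈ st(b)` ⟹ `‖(Δ′A)(b)‖ ≤ 14(d − 1)·(η²)⁻¹ε·a` — «This bound follows from the estimates |Re U(∂p) − 1|, |Im U(∂p)| ≤ …».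
[folklore] [cite: Balaban1985BackgroundPropagators, (3.69) p.404] -/
theorem eq369_local (hU1 : ∀ μ x, ‖(U μ x : 𝔸)‖ ≤ 1 ∧ ‖(((U μ x)⁻¹ : 𝔸ˣ) : 𝔸)‖ ≤ 1) {A : ι → S → 𝔸}
    {η a ε : ℝ} (μ : ι) (x : S)
    (hA : ∀ κ ν y, Through T μ x κ ν y → ‖A κ y‖ ≤ a ∧ ‖A ν (T κ y)‖ ≤ a ∧ ‖A κ (T ν y)‖ ≤ a ∧ ‖A ν y‖ ≤ a)
    (hplaq : ∀ κ ν y, Through T μ x κ ν y → ‖(plaqU T U κ ν y : 𝔸) - 1‖ ≤ ε) :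
    ‖deltaPrimeOp T U η A μ x‖ ≤ 14 * (a * ((η ^ 2)⁻¹ * ε)) * ((Fintype.card ι - 1 : ℕ) : ℝ) :=
  norm_deltaPrimeOp_le_local_one T U hU1 μ x hA (fun κ ν y h => norm_zP_le_of_plaq_one T U hU1 (hplaq κ ν y h))
    (fun κ ν y h => norm_yP_le_of_plaq_one T U hU1 (hplaq κ ν y h))

/-- `(L^{−j})²/η² = (L^jη)⁻²`: the `ξ²` of the display (`ξ = L^{−j}`) divided by the `η²` of `z(p)`, `y(p)` is the `(L^jη)⁻²` of
(3.69). [folklore] [cite: Balaban1985BackgroundPropagators, (3.69) p.404] -/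
theorem xi_sq_div_eta_sq (L η : ℝ) (j : ℕ) : (η ^ 2)⁻¹ * ((L ^ j)⁻¹) ^ 2 = ((L ^ j * η) ^ 2)⁻¹ := by
  rw [inv_pow, mul_pow, mul_inv, mul_comm]

/-- **(3.69) IN THE PRINTED SHAPE, group case**: if `‖U(b′)^{±1}‖ ≤ 1` and `‖U(∂p) − 1‖ ≤ C·(L^j)⁻²` (`= Cξ²`, `ξ = L^{−j}`) on the
plaquettes `p ∈ st(b)`, and `‖A(b′)‖ ≤ a` for `b′ ⊂ ∂p`, `p ∈ st(b)`, then
`‖(Δ′A)(b)‖ ≤ (14(d − 1))·C·(L^jη)⁻²·a` — `|(Δ′A′)(b)| ≤ O(1)(Mα₀ + α₁)(L^jη)⁻²|A′|` with `O(1) = 14(d − 1)` and the print's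
`(Mα₀ + α₁)` entering through the hypothesis constant `C`. [folklore] [cite: Balaban1985BackgroundPropagators, (3.69) p.404] -/
theorem eq369 (hU1 : ∀ μ x, ‖(U μ x : 𝔸)‖ ≤ 1 ∧ ‖(((U μ x)⁻¹ : 𝔸ˣ) : 𝔸)‖ ≤ 1) {A : ι → S → 𝔸}
    {η a C L : ℝ} {j : ℕ} (μ : ι) (x : S)
    (hA : ∀ κ ν y, Through T μ x κ ν y → ‖A κ y‖ ≤ a ∧ ‖A ν (T κ y)‖ ≤ a ∧ ‖A κ (T ν y)‖ ≤ a ∧ ‖A ν y‖ ≤ a)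
    (hplaq : ∀ κ ν y, Through T μ x κ ν y → ‖(plaqU T U κ ν y : 𝔸) - 1‖ ≤ C * ((L ^ j)⁻¹) ^ 2) :
    ‖deltaPrimeOp T U η A μ x‖ ≤ (14 * ((Fintype.card ι - 1 : ℕ) : ℝ)) * C * ((L ^ j * η) ^ 2)⁻¹ * a := by
  refine (eq369_local T U hU1 μ x hA hplaq).trans (le_of_eq ?_)
  rw [← xi_sq_div_eta_sq]
  ring

/-- **(3.69) FROM THE PLAQUETTE SMALLNESS, non-unitary bond variables** (`‖U(b′)^{±1}‖ ≤ ρ`, `1 ≤ ρ`; the complex configurations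
`U′U` of (3.37) have `ρ = e^{O(α₁)}`): `‖U(∂p) − 1‖ ≤ ε` on `st(b)` ⟹ `‖(Δ′A)(b)‖ ≤ 14ρ⁴(d − 1)·(η²)⁻¹·½(1 + ρ⁴)ε·a`. [folklore]
[cite: Balaban1985BackgroundPropagators, (3.69) p.404; (3.37) p.396] -/
theorem eq369_local_rho {ρ : ℝ} (hρ : 1 ≤ ρ) (hUρ : ∀ μ x, ‖(U μ x : 𝔸)‖ ≤ ρ ∧ ‖(((U μ x)⁻¹ : 𝔸ˣ) : 𝔸)‖ ≤ ρ)
    {A : ι → S → 𝔸} {η a ε : ℝ} (μ : ι) (x : S)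
    (hA : ∀ κ ν y, Through T μ x κ ν y → ‖A κ y‖ ≤ a ∧ ‖A ν (T κ y)‖ ≤ a ∧ ‖A κ (T ν y)‖ ≤ a ∧ ‖A ν y‖ ≤ a)
    (hplaq : ∀ κ ν y, Through T μ x κ ν y → ‖(plaqU T U κ ν y : 𝔸) - 1‖ ≤ ε) :
    ‖deltaPrimeOp T U η A μ x‖
      ≤ 14 * ρ ^ 4 * (a * ((η ^ 2)⁻¹ * ((1 + ρ ^ 4) / 2 * ε))) * ((Fintype.card ι - 1 : ℕ) : ℝ) :=
  norm_deltaPrimeOp_le_local T U hρ hUρ μ x hA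
    (fun κ ν y h => norm_zP_le_of_plaq T U (norm_plaqU_inv_le T U hUρ κ ν y) (hplaq κ ν y h))
    (fun κ ν y h => norm_yP_le_of_plaq T U (norm_plaqU_inv_le T U hUρ κ ν y) (hplaq κ ν y h))

end Local

/-! ### Locality of `Δ′`: `(Δ′A)(b)` depends on `A` only through `A(b′)`, `b′ ⊂ ∂p`, `p ∈ st(b)` -/

section Locality

variable {𝔸 : Type*} [Ring 𝔸] [Algebra ℂ 𝔸] {S : Type*} {ι : Type*}
variable (T : ι → Equiv.Perm S) (U : ι → S → 𝔸ˣ)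

omit [Algebra ℂ 𝔸] in
/-- The curl and the signed partner sums at `p` are determined by `A` on the four boundary bonds of `p`. [folklore]
[cite: Balaban1985BackgroundPropagators, (3.4) p.391] -/
theorem letters_congr {A A' : ι → S → 𝔸} {κ ν : ι} {y : S} (h₁ : A κ y = A' κ y) (h₂ : A ν (T κ y) = A' ν (T κ y))
    (h₃ : A κ (T ν y) = A' κ (T ν y)) (h₄ : A ν y = A' ν y) :
    curl T U A κ ν y = curl T U A' κ ν y ∧ sgnSum₁ T U A κ ν y = sgnSum₁ T U A' κ ν y
      ∧ sgnSum₂ T U A κ ν y = sgnSum₂ T U A' κ ν y ∧ sgnSum₃ T U A κ ν y = sgnSum₃ T U A' κ ν y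
      ∧ sgnSum₄ T U A κ ν y = sgnSum₄ T U A' κ ν y := by
  simp only [curl, covD, sgnSum₁, sgnSum₂, sgnSum₃, sgnSum₄, h₁, h₂, h₃, h₄, and_self]

/-- … hence so are the Jordan letter function and the commutator letter functions. [folklore]
[cite: Balaban1985BackgroundPropagators, (3.10) p.392] -/
theorem jordanF_commG_congr (η : ℝ) {A A' : ι → S → 𝔸} {κ ν : ι} {y : S} (h₁ : A κ y = A' κ y)
    (h₂ : A ν (T κ y) = A' ν (T κ y)) (h₃ : A κ (T ν y) = A' κ (T ν y)) (h₄ : A ν y = A' ν y) :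
    jordanF T U η A κ ν y = jordanF T U η A' κ ν y ∧ commG₁ T U η A κ ν y = commG₁ T U η A' κ ν y
      ∧ commG₂ T U η A κ ν y = commG₂ T U η A' κ ν y ∧ commG₃ T U η A κ ν y = commG₃ T U η A' κ ν y
      ∧ commG₄ T U η A κ ν y = commG₄ T U η A' κ ν y := by
  obtain ⟨c, s₁, s₂, s₃, s₄⟩ := letters_congr T U h₁ h₂ h₃ h₄
  simp only [jordanF, commG₁, commG₂, commG₃, commG₄, c, s₁, s₂, s₃, s₄, and_self]

variable [Fintype ι] [LinearOrder ι]

omit [Algebra ℂ 𝔸] in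
/-- The letter divergence at `b` is determined by the letter functions on the plaquettes THROUGH `b`. [folklore]
[cite: Balaban1985BackgroundPropagators, (3.9) p.392] -/
theorem divL_congr_local {G₁ G₂ G₃ G₄ G₁' G₂' G₃' G₄' : ι → ι → S → 𝔸} (μ : ι) (x : S)
    (hG : ∀ κ ν y, Through T μ x κ ν y →
      G₁ κ ν y = G₁' κ ν y ∧ G₂ κ ν y = G₂' κ ν y ∧ G₃ κ ν y = G₃' κ ν y ∧ G₄ κ ν y = G₄' κ ν y) :
    divL T U G₁ G₂ G₃ G₄ μ x = divL T U G₁' G₂' G₃' G₄' μ x := by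
  unfold divL
  congr 1
  · refine Finset.sum_congr rfl fun ν _ => ?_
    split_ifs with h
    · rw [(hG _ _ _ ⟨h, Or.inl ⟨rfl, Or.inr rfl⟩⟩).2.2.2, (hG _ _ _ ⟨h, Or.inl ⟨rfl, Or.inl rfl⟩⟩).2.1]
    · rfl
  · refine Finset.sum_congr rfl fun ν _ => ?_
    split_ifs with h
    · rw [(hG _ _ _ ⟨h, Or.inr ⟨rfl, Or.inr rfl⟩⟩).1, (hG _ _ _ ⟨h, Or.inr ⟨rfl, Or.inl rfl⟩⟩).2.2.1]
    · rfl

/-- **LOCALITY OF `Δ′`** — the typed content of «the supremum on the right-hand side is taken over bonds belonging to one of the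
plaquettes containing the bond b»: if two bond fields agree on the boundary bonds of every plaquette through `b`, then `Δ′` of
them agrees at `b`. [folklore] [cite: Balaban1985BackgroundPropagators, (3.69) p.404; (3.10) p.392] -/
theorem deltaPrimeOp_congr_local (η : ℝ) {A A' : ι → S → 𝔸} (μ : ι) (x : S)
    (hA : ∀ κ ν y, Through T μ x κ ν y →
      A κ y = A' κ y ∧ A ν (T κ y) = A' ν (T κ y) ∧ A κ (T ν y) = A' κ (T ν y) ∧ A ν y = A' ν y) :
    deltaPrimeOp T U η A μ x = deltaPrimeOp T U η A' μ x := by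
  have hJ : ∀ κ ν y, Through T μ x κ ν y → jordanF T U η A κ ν y = jordanF T U η A' κ ν y ∧
      jordanF T U η A κ ν y = jordanF T U η A' κ ν y ∧ jordanF T U η A κ ν y = jordanF T U η A' κ ν y ∧
      jordanF T U η A κ ν y = jordanF T U η A' κ ν y := by
    intro κ ν y h
    obtain ⟨h₁, h₂, h₃, h₄⟩ := hA κ ν y h
    have e := (jordanF_commG_congr T U η h₁ h₂ h₃ h₄).1
    exact ⟨e, e, e, e⟩
  have hG : ∀ κ ν y, Through T μ x κ ν y → commG₁ T U η A κ ν y = commG₁ T U η A' κ ν y ∧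
      commG₂ T U η A κ ν y = commG₂ T U η A' κ ν y ∧ commG₃ T U η A κ ν y = commG₃ T U η A' κ ν y ∧
      commG₄ T U η A κ ν y = commG₄ T U η A' κ ν y := by
    intro κ ν y h
    obtain ⟨h₁, h₂, h₃, h₄⟩ := hA κ ν y h
    exact (jordanF_commG_congr T U η h₁ h₂ h₃ h₄).2
  unfold deltaPrimeOp
  rw [← divL_self, ← divL_self, divL_congr_local T U μ x hJ, divL_congr_local T U μ x hG]

end Locality

/-! ## §4  Positivity of the principal part `D*D_U` on the unitary group («a small perturbation of D*D») -/

section Positivity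

variable {𝔸 : Type*} [Ring 𝔸] [Algebra ℂ 𝔸] [StarRing 𝔸] [StarModule ℂ 𝔸]
variable {S : Type*} [Fintype S] {ι : Type*} [Fintype ι] [LinearOrder ι]
variable (T : ι → Equiv.Perm S) (U : ι → S → 𝔸ˣ)

/-- **`⟨A, D*D_U A⟩ ≥ 0`** (real part) for hermitian bond fields on the unitary group, for a tracial `τ` with `Re τ(a*a) ≥ 0`
(e.g. the matrix trace) and `η ≥ 0`: by (3.10)'s `⟨A, D*D_U A⟩ = Σ_p η^d τ(((D_U A)(p))²)` (`bondPair_divPη_curlη`) and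
`((D_U A)(p))* = (D_U A*)(p) = (D_U A)(p)` (`star_curlη`), each summand is `τ(X*X)`. [folklore]
[cite: Balaban1985BackgroundPropagators, (3.10) p.392; p.404 «Δ(U′U) = D*_{U′U}D_{U′U} + Δ′(U′U)»] -/
theorem bondPair_DstarD_re_nonneg (hU : ∀ μ x, (((U μ x)⁻¹ : 𝔸ˣ) : 𝔸) = star (U μ x : 𝔸)) (τ : 𝔸 →ₗ[ℂ] ℂ)
    (hτ : ∀ a b : 𝔸, τ (a * b) = τ (b * a)) (hτpos : ∀ a : 𝔸, 0 ≤ (τ (star a * a)).re) {η : ℝ} (hη : 0 ≤ η)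
    (d : ℕ) {A : ι → S → 𝔸} (hA : ∀ μ x, star (A μ x) = A μ x) :
    0 ≤ (bondPair η d τ A (divPη T U η (curlη T U η A))).re := by
  have hA' : star A = A := funext fun μ => funext fun x => hA μ x
  have hsq : ∀ q : S × ι × ι, 0 ≤ (τ (curlη T U η A q.2.1 q.2.2 q.1 * curlη T U η A q.2.1 q.2.2 q.1)).re := by
    intro q
    have e : star (curlη T U η A q.2.1 q.2.2 q.1) = curlη T U η A q.2.1 q.2.2 q.1 := by
      rw [show star (curlη T U η A q.2.1 q.2.2 q.1) = (star (curlη T U η A)) q.2.1 q.2.2 q.1 from rfl,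
        star_curlη T U hU, hA']
    have h := hτpos (curlη T U η A q.2.1 q.2.2 q.1)
    rwa [e] at h
  rw [bondPair_divPη_curlη T U τ hτ η d A, ← Complex.ofReal_pow, Complex.re_ofReal_mul, Complex.re_sum]
  exact mul_nonneg (pow_nonneg hη d) (Finset.sum_nonneg fun q _ => hsq q)

end Positivity

section PositivityForm

variable {𝔸 : Type*} [NormedRing 𝔸] [NormedAlgebra ℂ 𝔸] [StarRing 𝔸] [StarModule ℂ 𝔸]
variable {S : Type*} [Fintype S] {ι : Type*} [Fintype ι] [LinearOrder ι]
variable (T : ι → Equiv.Perm S) (U : ι → S → 𝔸ˣ)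

omit [StarRing 𝔸] [StarModule ℂ 𝔸] in
/-- `⟨A, D*D_U A⟩ = ⟨A, ΔA⟩ − ⟨A, Δ′A⟩` — (3.10) read as `D*D = Δ − Δ′` (`B9Eq39Adjoint.hessPair`, `deltaPrime`). [folklore]
[cite: Balaban1985BackgroundPropagators, (3.10) p.392] -/
theorem bondPair_DstarD_eq (η : ℝ) (d : ℕ) (τ : 𝔸 →ₗ[ℂ] ℂ) (A : ι → S → 𝔸) :
    bondPair η d τ A (divPη T U η (curlη T U η A)) = hessPair T U η d τ A - deltaPrime T U η d τ A := by
  rw [hessPair, add_sub_cancel_right]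

/-- `Im ⟨A, D*D_U A⟩ = 0` on the unitary group for hermitian `A` and a tracial `*`-compatible `τ` (from the lineage leaf's
`hessPair_im`, `deltaPrime_im`). [folklore] [cite: Balaban1985BackgroundPropagators, (3.10) p.392] -/
theorem bondPair_DstarD_im (hU : ∀ μ x, (((U μ x)⁻¹ : 𝔸ˣ) : 𝔸) = star (U μ x : 𝔸)) (τ : 𝔸 →ₗ[ℂ] ℂ)
    (hτ : ∀ a b : 𝔸, τ (a * b) = τ (b * a)) (hτs : ∀ a : 𝔸, τ (star a) = starRingEnd ℂ (τ a)) (η : ℝ) (d : ℕ)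
    {A : ι → S → 𝔸} (hA : ∀ μ x, star (A μ x) = A μ x) :
    (bondPair η d τ A (divPη T U η (curlη T U η A))).im = 0 := by
  rw [bondPair_DstarD_eq, Complex.sub_im, hessPair_im T U hU τ hτ hτs η d hA, deltaPrime_im T U hU τ hτ hτs η d hA,
    sub_zero]

omit [StarRing 𝔸] [StarModule ℂ 𝔸] in
/-- `Re ⟨A, ΔA⟩ = Re ⟨A, D*D_U A⟩ + Re ⟨A, Δ′A⟩`. [folklore] [cite: Balaban1985BackgroundPropagators, (3.10) p.392] -/
theorem hessPair_re (η : ℝ) (d : ℕ) (τ : 𝔸 →ₗ[ℂ] ℂ) (A : ι → S → 𝔸) :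
    (hessPair T U η d τ A).re = (bondPair η d τ A (divPη T U η (curlη T U η A))).re + (deltaPrime T U η d τ A).re := by
  rw [hessPair, Complex.add_re]

/-- **`Re ⟨A, Δ′A⟩ ≤ Re ⟨A, ΔA⟩`** on the unitary group for hermitian `A`, tracial `τ` with `Re τ(a*a) ≥ 0`, `η ≥ 0`: in
`Δ = D*D + Δ′` the principal part is a POSITIVE form, `Δ′` the remainder bounded by (3.69) — «Δ′ … will be treated as a small
perturbation of D*D». [folklore] [cite: Balaban1985BackgroundPropagators, (3.10) p.392; (3.69) p.404] -/
theorem deltaPrime_re_le_hessPair_re (hU : ∀ μ x, (((U μ x)⁻¹ : 𝔸ˣ) : 𝔸) = star (U μ x : 𝔸)) (τ : 𝔸 →ₗ[ℂ] ℂ)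
    (hτ : ∀ a b : 𝔸, τ (a * b) = τ (b * a)) (hτpos : ∀ a : 𝔸, 0 ≤ (τ (star a * a)).re) {η : ℝ} (hη : 0 ≤ η)
    (d : ℕ) {A : ι → S → 𝔸} (hA : ∀ μ x, star (A μ x) = A μ x) :
    (deltaPrime T U η d τ A).re ≤ (hessPair T U η d τ A).re := by
  rw [hessPair_re]
  exact le_add_of_nonneg_left (bondPair_DstarD_re_nonneg T U hU τ hτ hτpos hη d hA)

end PositivityForm

/-! ## §5  Sanity: `st(b)` is inhabited and positively oriented; the trivial background -/

section Examples

variable {𝔸 : Type*} [NormedRing 𝔸] [NormedAlgebra ℂ 𝔸] {S : Type*} {ι : Type*} [Fintype ι] [LinearOrder ι]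
variable (T : ι → Equiv.Perm S)

omit [Fintype ι] in
/-- For `μ < ν` the plaquette `p_{μν}(x)` is through the bond `⟨x, x+e_μ⟩`. [folklore] -/
theorem through_self {μ ν : ι} (h : μ < ν) (x : S) : Through T μ x μ ν x := ⟨h, Or.inr ⟨rfl, Or.inl rfl⟩⟩

omit [Fintype ι] in
/-- … and so is `p_{νμ}(x − e_ν)` for `ν < μ`. [folklore] -/
theorem through_pred {μ ν : ι} (h : ν < μ) (x : S) : Through T μ x ν μ ((T ν).symm x) :=
  ⟨h, Or.inl ⟨rfl, Or.inr rfl⟩⟩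

omit [Fintype ι] in
/-- Every plaquette through a bond is positively oriented and has the bond's direction as one of its two directions. [folklore] -/
theorem through_lt_and {μ : ι} {x : S} {κ ν : ι} {y : S} (h : Through T μ x κ ν y) : κ < ν ∧ (κ = μ ∨ ν = μ) :=
  ⟨h.1, h.2.elim (fun h' => Or.inr h'.1) fun h' => Or.inl h'.1⟩

omit [NormedAlgebra ℂ 𝔸] [Fintype ι] [LinearOrder ι] in
/-- Trivial background `U ≡ 1`: `U(∂p) = 1`, so the plaquette smallness holds with `ε = 0`. [folklore] -/
theorem plaqU_one (κ ν : ι) (y : S) : (plaqU T (fun (_ : ι) (_ : S) => (1 : 𝔸ˣ)) κ ν y : 𝔸) - 1 = 0 := by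
  simp [plaqU]

/-- … whence (3.69) bounds `Δ′` of the trivial background by `0` (consistent with `Δ′ = 0` there, `B9Eq310Hermitian` §6). -/
example [NormOneClass 𝔸] (η a : ℝ) (A : ι → S → 𝔸) (hA : ∀ μ x, ‖A μ x‖ ≤ a) (μ : ι) (x : S) :
    ‖deltaPrimeOp T (fun (_ : ι) (_ : S) => (1 : 𝔸ˣ)) η A μ x‖ ≤ 14 * (a * ((η ^ 2)⁻¹ * 0)) * ((Fintype.card ι - 1 : ℕ) : ℝ) :=
  eq369_local T _ (fun _ _ => ⟨by simp, by simp⟩) μ x (fun _ _ _ _ => ⟨hA _ _, hA _ _, hA _ _, hA _ _⟩)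
    (fun κ ν y _ => by rw [plaqU_one T κ ν y, norm_zero])

end Examples

end Literature.MathematicalPhysics.QuantumFieldTheory.Balaban1983to89.B9Eq369Small
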